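import Summits.MatrixMultiplication.OmegaCensus.TorusFiveNinths

/-!
# ω-census (tpp lane): PROOF of the 5/9 torus theorem `TorusDensity.FiveNinthsTorus` (kernel-checked discharging certificate)

Contributed by the speedrun lane `tpp` (summit MatrixMultiplication), seat `sr-tpp-search-g22` (2026-08-24; source
`run/shared/lean/speedrun/tpp/sr-tpp-search-g22/lean/TorusFiveNinthsProof.lean` v3, 914 lines, sha256
`8246c8148034ac501ead741d201aede3e556ac7f950f8d9e828748e18e85fd2b`, farm `lean check` rc 0, axioms `propext`, `Classical.choice`, `Quot.sound` only),
split into three tree files (`TorusFiveNinthsTheorem` §§1–5, `TorusPairBound` §6, `TorusTransversalEquiv` §§7–9) and restyled by seat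
`sr-tpp-search-g30` (2026-08-26: the verbatim copies of `upFace` / `ValidUp` / `FiveNinthsTorus` / `PairSatTPP` / `FiveNinthsPairBound` that made
the lane file self-contained are DROPPED — every theorem now speaks about the tree declarations of `TorusFiveNinths.lean` and
`PairWallFiveNinths.lean` directly; a docstring on every declaration; proofs unchanged).
Framing: lottery ticket; floor = certified bounds/negative ranges.  Nothing in this file is progress on `ω`; it records STRUCTURE of the small-group TPP census (lane documents `run/shared/lean/speedrun/tpp/STRUCTURE.md`, `WRITEUP-A.md`).

THEOREM (`fiveNinthsTorus : TorusDensity.FiveNinthsTorus`).  For every prime `p ≡ 1 (mod 3)` and `u` with `u³ = 1 ≠ u`, every VALID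
`U ⊂ ℤ_p` (each `x ∈ U` owns an up-face `{z, z+1, z+1+u} ∋ x` meeting `U` only in `x`) has `9·|U| ≤ 5·p`.
METHOD.  An exact discharging certificate on the radius-2 hexagonal window (29 rational potentials with denominator 36, found as the
coarse-key dual of a translation-consistency LP; lane file `sr-tpp-search-g22/Q6-CERTIFICATE.md`), checked by the KERNEL (`decide`) on the
`2⁸` relevant sub-patterns (§1: the certificate reads only 8 window points and local validity is antitone, so the 256 "rest empty" patterns
imply the inequality for all `2¹⁹` window patterns, §2), pulled back to `ℤ_p` along `(i, j) ↦ i + j·u` (§3) and summed over the torus,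
where the potential terms telescope (§4).  Negative control (lane v1): replacing `20` by `19` in `ineqB` makes the check fail (45 152 tight
patterns).  No sorry; axioms: the standard three (v2 of the lane file replaced v1's `native_decide` over `2¹⁹` masks by kernel `decide` over 256).
-/

namespace Summit.MatrixMultiplication.OmegaCensus.SpeedrunTPP.TorusDensity.Proof

/-! ## 1. The window certificate (kernel-checked by `decide`) -/
section Cert

/-- The radius-2 hexagonal window `W : Fin 19 → ℤ × ℤ` (axial coordinates), sorted lexicographically; `W 9 = (0,0)`. -/
def W : Fin 19 → ℤ × ℤ := ![(-2, -2), (-2, -1), (-2, 0), (-1, -2), (-1, -1), (-1, 0), (-1, 1), (0, -2), (0, -1), (0, 0), (0, 1), (0, 2), (1, -1), (1, 0), (1, 1), (1, 2), (2, 0), (2, 1), (2, 2)]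

/-- Local-validity checks: for each of the 7 inner points `k` (all six neighbours inside `W`) the indices of its three partner pairs
`(k, a₁, b₁, a₂, b₂, a₃, b₃)` with `W a₁ = W k + (1,0)`, `W b₁ = W k + (1,1)`, `W a₂ = W k + (-1,0)`, `W b₂ = W k + (0,1)`, `W a₃ = W k + (-1,-1)`, `W b₃ = W k + (0,-1)`. -/
def checks : List (Fin 19 × Fin 19 × Fin 19 × Fin 19 × Fin 19 × Fin 19 × Fin 19) :=
  [(4, 8, 9, 1, 5, 0, 3), (5, 9, 10, 2, 6, 1, 4), (8, 12, 13, 4, 9, 3, 7), (9, 13, 14, 5, 10, 4, 8), (10, 14, 15, 6, 11, 5, 9), (13, 16, 17, 9, 14, 8, 12), (14, 17, 18, 10, 15, 9, 13)]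

/-- A pattern `v` (membership bits on `W`) is LOCALLY VALID if every inner point in the pattern has a partner pair outside it. -/
def locValidB (v : Fin 19 → Bool) : Bool :=
  checks.all fun e => !v e.1 || (!v e.2.1 && !v e.2.2.1) || (!v e.2.2.2.1 && !v e.2.2.2.2.1) || (!v e.2.2.2.2.2.1 && !v e.2.2.2.2.2.2)

/-- Potential of the telescoping family `s = (1, 0)` (×36), a function of the pattern bits on the key points
`(0, -1), (0, 0), (0, 1), (1, 0), (1, 1)` (indices `[8, 9, 10, 13, 14]`); read at the shifted key points `A - s` it uses indices `[4, 5, 6, 9, 10]`. -/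
def Λ1 : Bool → Bool → Bool → Bool → Bool → ℤ
  | true, false, false, false, false => 1
  | false, true, false, false, false => 11
  | true, true, false, false, false => 18
  | false, true, true, false, false => 11
  | true, true, true, false, false => 18
  | false, false, false, true, false => -1
  | true, true, false, true, false => 5
  | false, false, true, true, false => -1
  | false, false, false, false, true => -3
  | true, true, false, false, true => 7
  | false, false, true, false, true => -3
  | false, true, true, false, true => 4
  | false, false, false, true, true => -2
  | false, true, false, true, true => -3
  | true, true, false, true, true => 2
  | true, false, true, true, true => 3
  | false, true, true, true, true => 1
  | _, _, _, _, _ => 0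

/-- Potential of the telescoping family `s = (0, 1)` (×36), a function of the pattern bits on the key points
`(-1, 0), (0, 0), (0, 1), (1, 1)` (indices `[5, 9, 10, 14]`); read at the shifted key points `A - s` it uses indices `[4, 8, 9, 13]`. -/
def Λ2 : Bool → Bool → Bool → Bool → ℤ
  | false, true, false, false => 6
  | true, true, false, false => 3
  | false, false, true, false => -14
  | true, false, true, false => -7
  | false, true, true, false => 1
  | true, false, false, true => 1
  | false, true, false, true => 9
  | true, true, false, true => 2
  | false, false, true, true => -17
  | true, false, true, true => -10
  | false, true, true, true => -4
  | true, true, true, true => -5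
  | _, _, _, _ => 0

/-- The telescoping part of the certificate: `Σ_s (Λ_s[key at x] − Λ_s[key at x − s])` (×36). -/
def Φ (v : Fin 19 → Bool) : ℤ :=
  (Λ1 (v 8) (v 9) (v 10) (v 13) (v 14) - Λ1 (v 4) (v 5) (v 6) (v 9) (v 10)) + (Λ2 (v 5) (v 9) (v 10) (v 14) - Λ2 (v 4) (v 8) (v 9) (v 13))

/-- The certificate inequality (×36): `36·[origin ∈ pattern] ≤ 20 + Φ`, i.e. `[0 ∈ P] ≤ 5/9 + telescoping terms`. -/
def ineqB (v : Fin 19 → Bool) : Bool := decide (36 * (if v 9 then (1 : ℤ) else 0) ≤ 20 + Φ v)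

/-- The 8 RELEVANT window points: the certificate reads the pattern only at indices `4,5,6,8,9,10,13,14`
(the key points of both families and their shifts), and all 7 inner points are among them. -/
def Semb : Fin 8 → Fin 19 := ![4, 5, 6, 8, 9, 10, 13, 14]

/-- Extend a pattern on the 8 relevant points by `false` (empty) elsewhere. -/
def embed (w : Fin 8 → Bool) : Fin 19 → Bool := fun k =>
  if k = 4 then w 0 else if k = 5 then w 1 else if k = 6 then w 2 else if k = 8 then w 3 else
  if k = 9 then w 4 else if k = 10 then w 5 else if k = 13 then w 6 else if k = 14 then w 7 else false

/-- The certificate as a Boolean test on the 2⁸ relevant sub-patterns (mask `m < 256`, rest of the window empty). -/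
def certW (m : ℕ) : Bool :=
  !locValidB (embed fun i : Fin 8 => m.testBit i.val) || ineqB (embed fun i : Fin 8 => m.testBit i.val)

set_option maxRecDepth 100000 in
/-- THE CERTIFICATE, kernel-checked by `decide` over the 256 relevant sub-patterns.  (Equivalent to the check over all
2¹⁹ window patterns — 189 768 locally valid, 45 152 tight — because emptying the 11 irrelevant points preserves local
validity and does not change the inequality; see `cert_v`.) -/
theorem certW_all : ∀ m : ℕ, m < 256 → certW m = true := by
  decide +kernel

end Cert

/-! ## 2. From the 256 relevant sub-patterns to arbitrary window patterns -/

/-- The mask of a pattern `v : Fin n → Bool` (bit `k` = `v k`). -/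
def maskOf : (n : ℕ) → (Fin n → Bool) → ℕ
  | 0, _ => 0
  | n + 1, v => Nat.bit (v 0) (maskOf n (fun k => v k.succ))

/-- Bit `k` of `maskOf n v` is `v k`. -/
theorem testBit_maskOf : ∀ (n : ℕ) (v : Fin n → Bool) (k : Fin n), (maskOf n v).testBit k.val = v k
  | 0, _, k => k.elim0
  | n + 1, v, k => by
      cases k using Fin.cases with
      | zero => simp [maskOf]
      | succ k => simpa [maskOf, Nat.testBit_bit_succ] using testBit_maskOf n (fun k => v k.succ) k

/-- `maskOf n v < 2ⁿ`. -/
theorem maskOf_lt : ∀ (n : ℕ) (v : Fin n → Bool), maskOf n v < 2 ^ n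
  | 0, _ => by simp [maskOf]
  | n + 1, v => by
      have h := maskOf_lt n (fun k => v k.succ)
      simp only [maskOf, Nat.bit_val, pow_succ]
      cases v 0 <;> simp <;> omega

/-- Local validity is ANTITONE in the pattern: emptying points keeps a locally valid pattern locally valid. -/
theorem locValid_mono {v f : Fin 19 → Bool} (hle : ∀ k, f k = true → v k = true) (hv : locValidB v = true) :
    locValidB f = true := by
  simp only [locValidB, List.all_eq_true] at hv ⊢
  intro e he
  have h := hv e he
  have h1 := hle e.1; have h2 := hle e.2.1; have h3 := hle e.2.2.1; have h4 := hle e.2.2.2.1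
  have h5 := hle e.2.2.2.2.1; have h6 := hle e.2.2.2.2.2.1; have h7 := hle e.2.2.2.2.2.2
  simp only [Bool.or_eq_true, Bool.and_eq_true, Bool.not_eq_true', Bool.eq_false_iff] at h ⊢
  rcases h with ((h0 | ⟨ha, hb⟩) | ⟨ha, hb⟩) | ⟨ha, hb⟩
  · exact Or.inl (Or.inl (Or.inl fun hf => h0 (h1 hf)))
  · exact Or.inl (Or.inl (Or.inr ⟨fun hf => ha (h2 hf), fun hf => hb (h3 hf)⟩))
  · exact Or.inl (Or.inr ⟨fun hf => ha (h4 hf), fun hf => hb (h5 hf)⟩)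
  · exact Or.inr ⟨fun hf => ha (h6 hf), fun hf => hb (h7 hf)⟩

/-- Restricting a pattern to the 8 relevant points and re-embedding only removes points. -/
theorem embed_le (v : Fin 19 → Bool) : ∀ k, embed (fun i => v (Semb i)) k = true → v k = true := by
  intro k; fin_cases k <;> simp [embed, Semb]

/-- `Φ` reads only the 8 relevant points. -/
theorem Φ_embed (v : Fin 19 → Bool) : Φ (embed fun i => v (Semb i)) = Φ v := by
  simp [Φ, embed, Semb]

/-- The origin bit (index `9`) is one of the 8 relevant points. -/
theorem embed_9 (v : Fin 19 → Bool) : embed (fun i => v (Semb i)) 9 = v 9 := by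
  simp [embed, Semb]

/-- The certificate for an arbitrary locally valid pattern `v : Fin 19 → Bool`. -/
theorem cert_v (v : Fin 19 → Bool) (hv : locValidB v = true) :
    36 * (if v 9 then (1 : ℤ) else 0) ≤ 20 + Φ v := by
  set w : Fin 8 → Bool := fun i => v (Semb i) with hw
  have hvalid : locValidB (embed w) = true := locValid_mono (embed_le v) hv
  have hm := certW_all (maskOf 8 w) (lt_of_lt_of_eq (maskOf_lt 8 w) (by norm_num))
  have hb : (fun i : Fin 8 => (maskOf 8 w).testBit i.val) = w := funext fun i => testBit_maskOf 8 w i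
  rw [certW, hb, hvalid] at hm
  have hineq : 36 * (if embed w 9 then (1 : ℤ) else 0) ≤ 20 + Φ (embed w) := by simpa [ineqB] using hm
  rwa [Φ_embed, embed_9] at hineq

/-! ## 3. Pulling a valid set `U ⊂ ZMod p` back to window patterns -/
section Torus

variable {p : ℕ} (u : ZMod p) (U : Finset (ZMod p))

/-- The lattice-to-torus map `(i, j) ↦ i + j·u`. -/
def φ (f : ℤ × ℤ) : ZMod p := (f.1 : ZMod p) + (f.2 : ZMod p) * u

/-- `φ` is additive. -/
theorem φ_add (f g : ℤ × ℤ) : φ u (f + g) = φ u f + φ u g := by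
  simp only [φ, Prod.fst_add, Prod.snd_add]; push_cast; ring

/-- `φ` respects subtraction. -/
theorem φ_sub (f g : ℤ × ℤ) : φ u (f - g) = φ u f - φ u g := by
  simp only [φ, Prod.fst_sub, Prod.snd_sub]; push_cast; ring

/-- The window pattern of `U` seen from `t`: bit `k` = `[t + φ(W k) ∈ U]`. -/
def vt (t : ZMod p) : Fin 19 → Bool := fun k => decide (t + φ u (W k) ∈ U)

/-- The pattern bit at `W j = W i + d` is membership of `t + φ(W i) + φ d`. -/
theorem vt_of_eq (t : ZMod p) (i j : Fin 19) (d : ℤ × ℤ) (h : W j = W i + d) :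
    vt u U t j = decide (t + φ u (W i) + φ u d ∈ U) := by
  simp [vt, h, φ_add, add_assoc]

/-- Shifting the window: the bit at `W j = W i − s` seen from `t` is the bit at `W i` seen from `t − φ s`. -/
theorem vt_shift (t : ZMod p) (i j : Fin 19) (s : ℤ × ℤ) (h : W j = W i - s) :
    vt u U t j = vt u U (t - φ u s) i := by
  simp only [vt, h, φ_sub]
  ring_nf

/-- One step of validity: a point of `U` has a partner pair outside `U`. -/
theorem partners (hU : ValidUp p u U) (h10 : (1 : ZMod p) ≠ 0) (hu0 : u ≠ 0) (h1u : 1 + u ≠ 0)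
    (y : ZMod p) (hy : y ∈ U) :
    (y + 1 ∉ U ∧ y + (1 + u) ∉ U) ∨ (y + (-1) ∉ U ∧ y + u ∉ U) ∨ (y + (-1 - u) ∉ U ∧ y + (-u) ∉ U) := by
  obtain ⟨z, hz, hface⟩ := hU y hy
  have key : ∀ w, w ∈ upFace p u z → w ∈ U → w = y := by
    intro w hw hwU
    have hmem : w ∈ upFace p u z ∩ U := Finset.mem_inter.mpr ⟨hw, hwU⟩
    rw [hface] at hmem
    simpa using hmem
  simp only [Finset.mem_insert, Finset.mem_singleton] at hz
  rcases hz with rfl | rfl | rfl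
  · -- `rfl` has replaced `y` by `z` here
    refine Or.inl ⟨fun h => ?_, fun h => ?_⟩
    · have e := key _ (by simp [upFace]) h
      exact h10 (by linear_combination e)
    · have e := key _ (by simp [upFace, add_assoc]) h
      exact h1u (by linear_combination e)
  · refine Or.inr (Or.inl ⟨fun h => ?_, fun h => ?_⟩)
    · have e := key (y + (-1)) (by rw [show y + (-1) = y - 1 by ring]; simp [upFace]) h
      exact h10 (by linear_combination -e)
    · have e := key (y + u) (by rw [show y + u = y - 1 + 1 + u by ring]; simp [upFace]) h
      exact hu0 (by linear_combination e)
  · refine Or.inr (Or.inr ⟨fun h => ?_, fun h => ?_⟩)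
    · have e := key (y + (-1 - u)) (by rw [show y + (-1 - u) = y - 1 - u by ring]; simp [upFace]) h
      exact h1u (by linear_combination -e)
    · have e := key (y + (-u)) (by rw [show y + (-u) = y - 1 - u + 1 by ring]; simp [upFace]) h
      exact hu0 (by linear_combination -e)

/-- Pulled-back patterns of a valid set are locally valid. -/
theorem locValid_vt (hU : ValidUp p u U) (h10 : (1 : ZMod p) ≠ 0) (hu0 : u ≠ 0) (h1u : 1 + u ≠ 0)
    (t : ZMod p) : locValidB (vt u U t) = true := by
  have geom : ∀ e ∈ checks, W e.2.1 = W e.1 + (1, 0) ∧ W e.2.2.1 = W e.1 + (1, 1) ∧ W e.2.2.2.1 = W e.1 + (-1, 0) ∧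
      W e.2.2.2.2.1 = W e.1 + (0, 1) ∧ W e.2.2.2.2.2.1 = W e.1 + (-1, -1) ∧ W e.2.2.2.2.2.2 = W e.1 + (0, -1) := by
    decide
  have f10 : φ u (1, 0) = 1 := by simp [φ]
  have f11 : φ u (1, 1) = 1 + u := by simp [φ]
  have fm10 : φ u (-1, 0) = -1 := by simp [φ]
  have f01 : φ u (0, 1) = u := by simp [φ]
  have fm1m1 : φ u (-1, -1) = -1 - u := by simp [φ]; ring
  have f0m1 : φ u (0, -1) = -u := by simp [φ]
  simp only [locValidB, List.all_eq_true]
  intro e he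
  obtain ⟨h1, h2, h3, h4, h5, h6⟩ := geom e he
  rw [vt_of_eq u U t _ _ _ h1, vt_of_eq u U t _ _ _ h2, vt_of_eq u U t _ _ _ h3, vt_of_eq u U t _ _ _ h4,
    vt_of_eq u U t _ _ _ h5, vt_of_eq u U t _ _ _ h6, f10, f11, fm10, f01, fm1m1, f0m1]
  by_cases hy : t + φ u (W e.1) ∈ U
  · have hp := partners u U hU h10 hu0 h1u _ hy
    simp only [vt, Bool.or_eq_true, Bool.and_eq_true, Bool.not_eq_true', decide_eq_false_iff_not, or_assoc]
    exact Or.inr hp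
  · simp [vt, hy]

/-! ## 4. Telescoping over the torus and the count -/

/-- The `Λ1`-term read at the shifted key points from `t` equals the `Λ1`-term at the key points from `t − 1` (family `s = (1,0)`). -/
theorem Λ1_shift (t : ZMod p) :
    Λ1 (vt u U t 4) (vt u U t 5) (vt u U t 6) (vt u U t 9) (vt u U t 10) =
      Λ1 (vt u U (t - 1) 8) (vt u U (t - 1) 9) (vt u U (t - 1) 10) (vt u U (t - 1) 13) (vt u U (t - 1) 14) := by
  have hs : φ u (1, 0) = 1 := by simp [φ]
  rw [vt_shift u U t 8 4 (1, 0) (by decide), vt_shift u U t 9 5 (1, 0) (by decide),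
    vt_shift u U t 10 6 (1, 0) (by decide), vt_shift u U t 13 9 (1, 0) (by decide),
    vt_shift u U t 14 10 (1, 0) (by decide), hs]

/-- The `Λ2`-term read at the shifted key points from `t` equals the `Λ2`-term at the key points from `t − u` (family `s = (0,1)`). -/
theorem Λ2_shift (t : ZMod p) :
    Λ2 (vt u U t 4) (vt u U t 8) (vt u U t 9) (vt u U t 13) =
      Λ2 (vt u U (t - u) 5) (vt u U (t - u) 9) (vt u U (t - u) 10) (vt u U (t - u) 14) := by
  have hs : φ u (0, 1) = u := by simp [φ]
  rw [vt_shift u U t 5 4 (0, 1) (by decide), vt_shift u U t 9 8 (0, 1) (by decide),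
    vt_shift u U t 10 9 (0, 1) (by decide), vt_shift u U t 14 13 (0, 1) (by decide), hs]

variable [NeZero p]

/-- TELESCOPING: the potential part of the certificate sums to `0` over the torus `ℤ_p`. -/
theorem sum_Φ : ∑ t : ZMod p, Φ (vt u U t) = 0 := by
  have e1 : ∑ t : ZMod p, Λ1 (vt u U (t - 1) 8) (vt u U (t - 1) 9) (vt u U (t - 1) 10) (vt u U (t - 1) 13) (vt u U (t - 1) 14)
      = ∑ t : ZMod p, Λ1 (vt u U t 8) (vt u U t 9) (vt u U t 10) (vt u U t 13) (vt u U t 14) :=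
    Fintype.sum_equiv (Equiv.subRight (1 : ZMod p)) _ _ (fun t => rfl)
  have e2 : ∑ t : ZMod p, Λ2 (vt u U (t - u) 5) (vt u U (t - u) 9) (vt u U (t - u) 10) (vt u U (t - u) 14)
      = ∑ t : ZMod p, Λ2 (vt u U t 5) (vt u U t 9) (vt u U t 10) (vt u U t 14) :=
    Fintype.sum_equiv (Equiv.subRight u) _ _ (fun t => rfl)
  simp only [Φ, Λ1_shift, Λ2_shift, Finset.sum_add_distrib, Finset.sum_sub_distrib, e1, e2, sub_self, add_zero]

/-- The density bound on the torus `ZMod p` (any modulus with `1, u, 1+u` nonzero... here: the hypotheses). -/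
theorem card_le_of_valid (hU : ValidUp p u U) (h10 : (1 : ZMod p) ≠ 0) (hu0 : u ≠ 0) (h1u : 1 + u ≠ 0) :
    9 * U.card ≤ 5 * p := by
  have hpt : ∀ t : ZMod p, 36 * (if vt u U t 9 then (1 : ℤ) else 0) ≤ 20 + Φ (vt u U t) :=
    fun t => cert_v _ (locValid_vt u U hU h10 hu0 h1u t)
  have hsum := Finset.sum_le_sum fun t (_ : t ∈ (Finset.univ : Finset (ZMod p))) => hpt t
  have hind : ∀ t : ZMod p, (if vt u U t 9 then (1 : ℤ) else 0) = if t ∈ U then 1 else 0 := by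
    intro t; simp [vt, W, φ]
  have hcount : ∑ t : ZMod p, (if vt u U t 9 then (1 : ℤ) else 0) = U.card := by
    simp_rw [hind]
    rw [Finset.sum_boole]
    simp
  rw [← Finset.mul_sum, hcount, Finset.sum_add_distrib, sum_Φ, Finset.sum_const, Finset.card_univ, ZMod.card,
    nsmul_eq_mul, add_zero] at hsum
  have : (9 * U.card : ℤ) ≤ 5 * p := by linarith
  exact_mod_cast this

end Torus

/-! ## 5. The theorem -/

/-- **The 5/9 torus lemma** (Q6): every valid `U ⊂ ZMod p` has `9·|U| ≤ 5·p`. -/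
theorem fiveNinthsTorus : FiveNinthsTorus := by
  intro p hp hp3 u hu3 hu1 U hU
  haveI : Fact p.Prime := ⟨hp⟩
  have h10 : (1 : ZMod p) ≠ 0 := one_ne_zero
  have hu0 : u ≠ 0 := by
    rintro rfl
    norm_num at hu3
  have h1u : 1 + u ≠ 0 := by
    intro h
    have hu : u = -1 := by linear_combination h
    rw [hu] at hu3
    have h2 : (2 : ZMod p) = 0 := by linear_combination -hu3
    have h2' : ((2 : ℕ) : ZMod p) = 0 := by exact_mod_cast h2
    rw [CharP.cast_eq_zero_iff (ZMod p) p 2] at h2'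
    have := Nat.le_of_dvd (by norm_num) h2'
    have := hp.two_le
    omega
  exact card_le_of_valid u U hU h10 hu0 h1u

end Summit.MatrixMultiplication.OmegaCensus.SpeedrunTPP.TorusDensity.Proof
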